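import Summits.Schanuel.Schanuel.Theorems.ZilberEacLogDerivResidue
import Mathlib.Algebra.Polynomial.Reverse
import HarnessLib

/-!
# The equimodular class, XLIX: the analytic branch through ANY simple point, and one Newton–Puiseux
# step — a parametrised branch `z = a + t^e`, `y = η(t)` through a singular point of the fibre curve

HONEST FRAMING.  Cell `pub-schanuel` (Zilber's Exponential-Algebraic Closedness, case ladder;
host summit Schanuel), seat 2, gen 25.  Infrastructure for the ramified zeros and poles of an
algebraic branch (files XLVIII, L):
* **`exists_branchAt`**: `Q(a, b) = 0`, `∂_tQ(a, b) ≠ 0` ⟹ an analytic `η` near `a` with `η(a) = b`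
  and `Q(z, η z) = 0` (implicit function theorem; file XLII did `b = 0`).
* **`exists_newtonBranch`**: ONE NEWTON–PUISEUX STEP.  Suppose that after the substitution
  `z = a + t^e`, `y = t^μ·w` (`e, μ ≥ 1`) the fibre equation factors as
  `Q(a + t^e)(t^μ w) = t^ν · Q̃(t)(w)` for `t, w ≠ 0`, with `Q̃ ∈ ℂ[s][t]` having a SIMPLE NONZERO root
  `w₀` at `t = 0`.  Then there is an analytic `η` at `0` with `η(0) = 0`, `η ≢ 0` and
  `Q(a + t^e, η t) = 0` near `t = 0` (namely `η = t^μ·w(t)`, `w(0) = w₀`, from `exists_branchAt`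
  for `Q̃` at `(0, w₀)`); also `(a + t^e)' ≠ 0` for `t ≠ 0`.  A pole version
  (**`exists_newtonBranch_pole`**) produces `Q(a + t^e, 1/η t) = 0` on a punctured neighbourhood
  from the same data for the reversed polynomial, stated directly as
  `(t^μ w)^r · Q(a + t^e)(1/(t^μ w)) = t^ν · Q̃(t)(w)`.
[folklore]; nothing here is specific to Schanuel's conjecture (neither used nor implied).
-/

noncomputable section

open Filter Topology Polynomial
open scoped ContDiff

set_option linter.dupNamespace false

namespace Summit.Schanuel.Schanuel.Theorems

/-! ## Part A. The branch through a simple point `(a, b)` -/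

/-- **The analytic branch of `Q(z, y) = 0` through a simple point `(a, b)`** (`Q(a, b) = 0`,
`∂_tQ(a, b) ≠ 0`; implicit function theorem). [folklore] -/
theorem exists_branchAt (Q : ℂ[X][X]) {a b : ℂ} (hab : (Q.map (Polynomial.evalRingHom a)).IsRoot b)
    (hab' : ¬ ((derivative Q).map (Polynomial.evalRingHom a)).IsRoot b) :
    ∃ η : ℂ → ℂ, AnalyticAt ℂ η a ∧ η a = b ∧
      ∀ᶠ z in 𝓝 a, (Q.map (Polynomial.evalRingHom z)).eval (η z) = 0 := by
  classical
  set Φ : ℂ × ℂ → ℂ := fun v => ∑ j ∈ Finset.range (Q.natDegree + 1),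
      (Q.coeff j).eval v.1 * v.2 ^ j with hΦ
  have hΦcd : ContDiff ℂ ω Φ := by
    simp only [hΦ]
    refine ContDiff.sum fun j _ => ContDiff.mul ?_ (contDiff_snd.pow _)
    have h1 : ContDiff ℂ ω (fun x : ℂ => (Q.coeff j).eval x) := by
      simpa only [Polynomial.aeval_def, Polynomial.eval₂_eq_eval_map, Algebra.algebraMap_self,
        Polynomial.map_id] using (Q.coeff j).contDiff_aeval (𝕜 := ℂ) ω
    exact h1.comp contDiff_fst
  have hΦeq : ∀ z y : ℂ, Φ (z, y) = (Q.map (Polynomial.evalRingHom z)).eval y := fun z y =>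
    (evalPP_eq_sum Q z y (Nat.lt_succ_self _)).symm
  have hΦa : Φ (a, b) = 0 := by rw [hΦeq]; exact hab
  set Qa : ℂ[X] := Q.map (Polynomial.evalRingHom a) with hQa
  have hQa' : (derivative Qa).eval b ≠ 0 := by
    rw [hQa, Polynomial.derivative_map]; exact hab'
  have hΦat : ContDiffAt ℂ ω Φ (a, b) := hΦcd.contDiffAt
  have hcomp : HasFDerivAt (fun y : ℂ => Φ (a, y))
      ((fderiv ℂ Φ (a, b)).comp (ContinuousLinearMap.inr ℂ ℂ ℂ)) b :=
    (hΦat.differentiableAt (by simp)).hasFDerivAt.comp b (hasFDerivAt_prodMk_right a b)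
  have hTd : HasFDerivAt (fun y : ℂ => Φ (a, y))
      (ContinuousLinearMap.smulRight (1 : ℂ →L[ℂ] ℂ) ((derivative Qa).eval b)) b := by
    have e : (fun y : ℂ => Φ (a, y)) = fun y => Qa.eval y := funext fun y => hΦeq a y
    rw [e]
    exact (Polynomial.hasDerivAt Qa b).hasFDerivAt
  have hD2 : (fderiv ℂ Φ (a, b)).comp (ContinuousLinearMap.inr ℂ ℂ ℂ) =
      ContinuousLinearMap.smulRight (1 : ℂ →L[ℂ] ℂ) ((derivative Qa).eval b) := hcomp.unique hTd
  have hinv : ((fderiv ℂ Φ (a, b)).comp (ContinuousLinearMap.inr ℂ ℂ ℂ)).IsInvertible := by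
    rw [hD2]
    refine ⟨ContinuousLinearEquiv.unitsEquivAut ℂ (Units.mk0 _ hQa'), ?_⟩
    ext
    simp [ContinuousLinearEquiv.unitsEquivAut_apply]
  have hω : (ω : ℕ∞ω) ≠ 0 := by simp
  set η : ℂ → ℂ := hΦat.implicitFunction hω hinv with hη
  refine ⟨η, (hΦat.contDiffAt_implicitFunction hω hinv).analyticAt,
    hΦat.implicitFunction_apply_self hω hinv, ?_⟩
  have h := hΦat.eventually_apply_implicitFunction hω hinv
  rw [hΦa] at h
  filter_upwards [h] with z hz
  rw [← hΦeq]
  exact hz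

/-! ## Part B. One Newton–Puiseux step -/

/-- `(a + t^e)' = e t^{e-1} ≠ 0` for `t ≠ 0` (`e ≥ 1`). [folklore] -/
theorem deriv_newtonBase_ne_zero (a : ℂ) {e : ℕ} (he : 1 ≤ e) :
    ∀ᶠ t in 𝓝[≠] (0 : ℂ), deriv (fun s : ℂ => a + s ^ e) t ≠ 0 := by
  filter_upwards [self_mem_nhdsWithin] with t (ht : t ≠ 0)
  have hd : HasDerivAt (fun s : ℂ => a + s ^ e) ((e : ℂ) * t ^ (e - 1)) t := by
    simpa using ((hasDerivAt_id t).pow e |>.const_add a)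
  rw [hd.deriv]
  exact mul_ne_zero (Nat.cast_ne_zero.2 (by omega)) (pow_ne_zero _ ht)

/-- **One Newton–Puiseux step (zero form).**  See the module docstring. [folklore] -/
theorem exists_newtonBranch (Q Qt : ℂ[X][X]) (a : ℂ) {e μ ν : ℕ} (hμ : 1 ≤ μ)
    (hid : ∀ t w : ℂ, t ≠ 0 → w ≠ 0 →
      (Q.map (Polynomial.evalRingHom (a + t ^ e))).eval (t ^ μ * w) =
        t ^ ν * (Qt.map (Polynomial.evalRingHom t)).eval w)
    {w₀ : ℂ} (hw₀ : w₀ ≠ 0) (hroot : (Qt.map (Polynomial.evalRingHom 0)).IsRoot w₀)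
    (hsimple : ¬ ((derivative Qt).map (Polynomial.evalRingHom 0)).IsRoot w₀) :
    ∃ η : ℂ → ℂ, AnalyticAt ℂ η 0 ∧ η 0 = 0 ∧ (¬ ∀ᶠ t in 𝓝 (0 : ℂ), η t = 0) ∧
      ∀ᶠ t in 𝓝 (0 : ℂ), (Q.map (Polynomial.evalRingHom (a + t ^ e))).eval (η t) = 0 := by
  obtain ⟨w, hwan, hw0, hwroot⟩ := exists_branchAt Qt hroot hsimple
  have hwne : ∀ᶠ t in 𝓝 (0 : ℂ), w t ≠ 0 := hwan.continuousAt.eventually_ne (by rw [hw0]; exact hw₀)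
  set η : ℂ → ℂ := fun t => t ^ μ * w t with hη
  have hηan : AnalyticAt ℂ η 0 := (analyticAt_id.pow μ).mul hwan
  have hη0 : η 0 = 0 := by
    simp only [hη, zero_pow (by omega : μ ≠ 0), zero_mul]
  -- `Q(a + t^e, η t) = 0` for `t ≠ 0` near `0`, hence near `0`
  have hpunct : ∀ᶠ t in 𝓝[≠] (0 : ℂ), (Q.map (Polynomial.evalRingHom (a + t ^ e))).eval (η t) = 0 := by
    filter_upwards [self_mem_nhdsWithin, nhdsWithin_le_nhds hwroot, nhdsWithin_le_nhds hwne]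
      with t (ht : t ≠ 0) hQt hwt
    rw [hη]
    simp only
    rw [hid t (w t) ht hwt, hQt, mul_zero]
  -- continuity in `t` of `t ↦ Q(a + t^e, η t)`: a finite sum
  have hcont2 : ContinuousAt (fun t : ℂ => (Q.map (Polynomial.evalRingHom (a + t ^ e))).eval (η t)) 0 := by
    have e' : (fun t : ℂ => (Q.map (Polynomial.evalRingHom (a + t ^ e))).eval (η t)) =
        fun t => ∑ j ∈ Finset.range (Q.natDegree + 1), (Q.coeff j).eval (a + t ^ e) * η t ^ j := by
      funext t; exact evalPP_eq_sum Q _ _ (Nat.lt_succ_self _)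
    rw [e']
    refine tendsto_finsetSum _ fun j _ => ?_
    have hin : ContinuousAt (fun t : ℂ => a + t ^ e) 0 := continuousAt_const.add (continuousAt_id.pow e)
    exact ((analyticAt_polynomial_eval (Q.coeff j) _).continuousAt.comp (f := fun t : ℂ => a + t ^ e) hin).mul
      (hηan.continuousAt.pow j)
  have hall : ∀ᶠ t in 𝓝 (0 : ℂ), (Q.map (Polynomial.evalRingHom (a + t ^ e))).eval (η t) = 0 := by
    have hat : (Q.map (Polynomial.evalRingHom (a + (0 : ℂ) ^ e))).eval (η 0) = 0 :=
      eq_at_of_eventuallyEq_punctured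
        (F := fun t : ℂ => (Q.map (Polynomial.evalRingHom (a + t ^ e))).eval (η t))
        (G := fun _ => (0 : ℂ)) hcont2 continuousAt_const hpunct
    have h' : ∀ᶠ t in 𝓝[≠] (0 : ℂ),
        t ∈ {t : ℂ | (Q.map (Polynomial.evalRingHom (a + t ^ e))).eval (η t) = 0} := hpunct
    rw [eventually_nhdsWithin_iff] at h'
    filter_upwards [h'] with t ht
    by_cases h0 : t = 0
    · rw [h0]; exact hat
    · exact ht h0
  refine ⟨η, hηan, hη0, ?_, hall⟩
  -- `η ≢ 0`: `η t = t^μ w t ≠ 0` for `t ≠ 0` near `0`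
  intro hzero
  have h2 : ∀ᶠ t in 𝓝[≠] (0 : ℂ), False := by
    filter_upwards [self_mem_nhdsWithin, nhdsWithin_le_nhds hzero, nhdsWithin_le_nhds hwne]
      with t (ht : t ≠ 0) hηt hwt
    rw [hη] at hηt
    exact (mul_ne_zero (pow_ne_zero _ ht) hwt) hηt
  exact h2.exists.elim fun _ h => h

/-- **One Newton–Puiseux step (pole form)**: from
`(t^μ w)^r · Q(a + t^e)(1/(t^μ w)) = t^ν · Q̃(t)(w)` (`r = deg_t Q`) and a simple nonzero root `w₀`
of `Q̃(0)(·)`, a parametrised branch `y = 1/η(t)`, `η(0) = 0`, of `Q = 0` over `z = a + t^e`.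
[folklore] -/
theorem exists_newtonBranch_pole (Q Qt : ℂ[X][X]) (a : ℂ) {e μ ν : ℕ} (hμ : 1 ≤ μ)
    (hid : ∀ t w : ℂ, t ≠ 0 → w ≠ 0 →
      (t ^ μ * w) ^ Q.natDegree * (Q.map (Polynomial.evalRingHom (a + t ^ e))).eval (t ^ μ * w)⁻¹ =
        t ^ ν * (Qt.map (Polynomial.evalRingHom t)).eval w)
    {w₀ : ℂ} (hw₀ : w₀ ≠ 0) (hroot : (Qt.map (Polynomial.evalRingHom 0)).IsRoot w₀)
    (hsimple : ¬ ((derivative Qt).map (Polynomial.evalRingHom 0)).IsRoot w₀) :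
    ∃ η : ℂ → ℂ, AnalyticAt ℂ η 0 ∧ η 0 = 0 ∧ (¬ ∀ᶠ t in 𝓝 (0 : ℂ), η t = 0) ∧
      ∀ᶠ t in 𝓝[≠] (0 : ℂ), (Q.map (Polynomial.evalRingHom (a + t ^ e))).eval (η t)⁻¹ = 0 := by
  -- the identity for the reversed polynomial
  have hid' : ∀ t w : ℂ, t ≠ 0 → w ≠ 0 →
      (Q.reverse.map (Polynomial.evalRingHom (a + t ^ e))).eval (t ^ μ * w) =
        t ^ ν * (Qt.map (Polynomial.evalRingHom t)).eval w := by
    intro t w ht hw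
    have hx0 : t ^ μ * w ≠ 0 := mul_ne_zero (pow_ne_zero _ ht) hw
    haveI := invertibleOfNonzero (inv_ne_zero hx0)
    have h := Polynomial.eval₂_reverse_mul_pow (Polynomial.evalRingHom (a + t ^ e)) (t ^ μ * w)⁻¹ Q
    rw [invOf_eq_inv, inv_inv] at h
    have h2 : Polynomial.eval₂ (Polynomial.evalRingHom (a + t ^ e)) (t ^ μ * w) Q.reverse =
        (t ^ μ * w) ^ Q.natDegree *
          Polynomial.eval₂ (Polynomial.evalRingHom (a + t ^ e)) (t ^ μ * w)⁻¹ Q := by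
      rw [← h, inv_pow]
      field_simp
    have hid1 := hid t w ht hw
    rw [Polynomial.eval_map, Polynomial.eval_map] at hid1
    rw [Polynomial.eval_map, Polynomial.eval_map, h2, hid1]
  obtain ⟨η, hηan, hη0, hηne, hroot'⟩ := exists_newtonBranch Q.reverse Qt a hμ hid' hw₀ hroot hsimple
  refine ⟨η, hηan, hη0, hηne, ?_⟩
  have hηne' : ∀ᶠ t in 𝓝[≠] (0 : ℂ), η t ≠ 0 :=
    hηan.eventually_eq_zero_or_eventually_ne_zero.resolve_left hηne
  filter_upwards [hηne', nhdsWithin_le_nhds hroot'] with t hηt ht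
  haveI := invertibleOfNonzero (inv_ne_zero hηt)
  have h := Polynomial.eval₂_reverse_mul_pow (Polynomial.evalRingHom (a + t ^ e)) (η t)⁻¹ Q
  rw [Polynomial.eval_map] at ht ⊢
  rw [invOf_eq_inv, inv_inv, ht, zero_mul] at h
  exact h.symm

end Summit.Schanuel.Schanuel.Theorems
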